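import Literature.Topology.FourManifolds.TubeFirstReading
import HarnessLib

/-!
# First reading with offsets: the adapted model up to the secant error

Topic `Literature/Topology/FourManifolds`; sequel of `TubeFirstReading.lean` (Munkres, Ann. of Math. 72
(1960), §§4–5; Campbell–D'Onofrio–Vítek, J. Geom. Anal. (2026), §3).  In the secant-affine charts of the
downward sweep the tube axis is the SECANT simplex, not the curved simplex of the smooth triangulation, so
the model `u = (T, N)` of the PD map no longer satisfies `T (x, 0) = x`, `N (x, 0) = 0` exactly, only up
to the secant errors (Munkres, *Elementary differential topology* (1966), 9.3): `‖N (x, 0)‖ ≤ ε₀`,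
`‖T (x, 0) − x‖ ≤ ε₀` (of the order of curvature times mesh squared, much smaller than the tube radius)
and `‖D_x N (x, 0)‖ ≤ ε₁`, `‖D_x T (x, 0) − I‖ ≤ ε₁` (curvature times mesh).  The scale-`t` estimates of
`TubeFirstReading.lean` survive with these offsets added:

* `norm_normal_ge_offset` : `(m/2) t − ε₀ ≤ ‖N (x, y)‖`;
* `norm_source_defect_le_offset` : `(m/2) ‖u‖ ≤ 2 L t² + ε₀` for `D_yN u = D_yN·y − N`;
* `kernel_slope_le_offset` : `D N (v, w) = 0 ⟹ (m/2) ‖w‖ ≤ (L t + ε₁) ‖v‖`;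
* `norm_tangential_sub_le_offset` : `‖T (x, y) − x‖ ≤ M₁ t + ε₀`;
* `norm_fderiv_tangential_inl_sub_le_offset` : `‖D T (x, y)(v, 0) − v‖ ≤ (L t + ε₁) ‖v‖`.

Everything is proved from the offset-free generic estimates; no definitions; no named facts.

## References

* J. R. Munkres, *Obstructions to the smoothing of piecewise-differentiable homeomorphisms*, Ann.
  of Math. (2) 72 (1960), 521–554, §§4–5. [Munkres1960]
* J. R. Munkres, *Elementary differential topology*, Ann. of Math. Studies 54 (rev. 1966), 9.3.
  [Munkres1966]
-/

noncomputable section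

open Set Function Metric Filter
open scoped Topology ContDiff

namespace Literature.Topology.FourManifolds

variable {E : Type*} [NormedAddCommGroup E] [NormedSpace ℝ E]
variable {F : Type*} [NormedAddCommGroup F] [NormedSpace ℝ F]
variable {T : E × F → E} {N : E × F → F} {K : Set E} {r₀ : ℝ}

/-- **Lower bound for the normal part with offset**: `(m/2)‖y‖ − ‖N(x,0)‖ ≤ ‖N (x, y)‖` when
`L‖y‖ ≤ m/2`. [folklore] -/
theorem norm_normal_ge_offset (hN : ContDiff ℝ ∞ N) {L m : ℝ} (hL0 : 0 ≤ L)
    (hL : ∀ x ∈ K, ∀ y ∈ closedBall (0 : F) r₀, ∀ y' ∈ closedBall (0 : F) r₀,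
      ‖fderiv ℝ N (x, y) - fderiv ℝ N (x, y')‖ ≤ L * ‖y - y'‖)
    (hm : ∀ x ∈ K, ∀ w : F, m * ‖w‖ ≤ ‖fderiv ℝ N (x, 0) (0, w)‖)
    {x : E} (hx : x ∈ K) {y : F} (hy : y ∈ closedBall (0 : F) r₀)
    (hsmall : L * ‖y‖ ≤ m / 2) : m / 2 * ‖y‖ - ‖N (x, 0)‖ ≤ ‖N (x, y)‖ := by
  have h1 := norm_taylor_snd_le hN hL0 hL hx hy
  have h2 := hm x hx y
  have h3 : ‖fderiv ℝ N (x, 0) (0, y)‖ ≤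
      ‖N (x, y)‖ + ‖N (x, 0)‖ + ‖N (x, y) - N (x, 0) - fderiv ℝ N (x, 0) (0, y)‖ := by
    have e : fderiv ℝ N (x, 0) (0, y) = N (x, y) - N (x, 0) - (N (x, y) - N (x, 0) - fderiv ℝ N (x, 0) (0, y)) := by
      abel
    calc ‖fderiv ℝ N (x, 0) (0, y)‖
        = ‖N (x, y) - N (x, 0) - (N (x, y) - N (x, 0) - fderiv ℝ N (x, 0) (0, y))‖ := by rw [← e]
      _ ≤ ‖N (x, y) - N (x, 0)‖ + ‖N (x, y) - N (x, 0) - fderiv ℝ N (x, 0) (0, y)‖ := norm_sub_le _ _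
      _ ≤ ‖N (x, y)‖ + ‖N (x, 0)‖ + ‖N (x, y) - N (x, 0) - fderiv ℝ N (x, 0) (0, y)‖ :=
          add_le_add (norm_sub_le _ _) le_rfl
  have h4 : L * ‖y‖ ^ 2 ≤ m / 2 * ‖y‖ := by
    rw [pow_two, ← mul_assoc]; exact mul_le_mul_of_nonneg_right hsmall (norm_nonneg y)
  linarith

/-- **Source-form Euler defect with offset**: if `D N(x, y)(0, u) = D N(x, y)(0, y) − N(x, y)` then
`(m/2)‖u‖ ≤ 2L‖y‖² + ‖N(x,0)‖` (for `L‖y‖ ≤ m/2`). [folklore] -/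
theorem norm_source_defect_le_offset (hN : ContDiff ℝ ∞ N) {L m : ℝ} (hL0 : 0 ≤ L)
    (hL : ∀ x ∈ K, ∀ y ∈ closedBall (0 : F) r₀, ∀ y' ∈ closedBall (0 : F) r₀,
      ‖fderiv ℝ N (x, y) - fderiv ℝ N (x, y')‖ ≤ L * ‖y - y'‖)
    (hm : ∀ x ∈ K, ∀ w : F, m * ‖w‖ ≤ ‖fderiv ℝ N (x, 0) (0, w)‖)
    {x : E} (hx : x ∈ K) {y : F} (hy : y ∈ closedBall (0 : F) r₀) (hr₀ : 0 ≤ r₀)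
    (hsmall : L * ‖y‖ ≤ m / 2) {u : F}
    (hu : fderiv ℝ N (x, y) (0, u) = fderiv ℝ N (x, y) (0, y) - N (x, y)) :
    m / 2 * ‖u‖ ≤ 2 * L * ‖y‖ ^ 2 + ‖N (x, 0)‖ := by
  have h1 := fibre_derivative_lower_bound hL0 hL hm hx hy hr₀ hsmall u
  have h2 := norm_euler_defect_snd_le hN hL0 hL hx hy hr₀
  rw [hu] at h1
  have h3 : ‖fderiv ℝ N (x, y) (0, y) - N (x, y)‖ ≤
      ‖fderiv ℝ N (x, y) (0, y) - (N (x, y) - N (x, 0))‖ + ‖N (x, 0)‖ := by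
    have e : fderiv ℝ N (x, y) (0, y) - N (x, y) =
        (fderiv ℝ N (x, y) (0, y) - (N (x, y) - N (x, 0))) - N (x, 0) := by abel
    rw [e]; exact norm_sub_le _ _
  linarith

/-- **Kernel slope with offset**: `D N(x, y)(v, w) = 0 ⟹ (m/2)‖w‖ ≤ (L‖y‖ + ε₁)‖v‖` where `ε₁`
bounds the tangential derivative of `N` on the zero section, `‖D N(x, 0)(v, 0)‖ ≤ ε₁‖v‖`.
[folklore] -/
theorem kernel_slope_le_offset {L m ε₁ : ℝ} (hL0 : 0 ≤ L)
    (hL : ∀ x ∈ K, ∀ y ∈ closedBall (0 : F) r₀, ∀ y' ∈ closedBall (0 : F) r₀,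
      ‖fderiv ℝ N (x, y) - fderiv ℝ N (x, y')‖ ≤ L * ‖y - y'‖)
    (hm : ∀ x ∈ K, ∀ w : F, m * ‖w‖ ≤ ‖fderiv ℝ N (x, 0) (0, w)‖)
    (hNx : ∀ x ∈ K, ∀ v : E, ‖fderiv ℝ N (x, 0) (v, 0)‖ ≤ ε₁ * ‖v‖)
    {x : E} (hx : x ∈ K) {y : F} (hy : y ∈ closedBall (0 : F) r₀) (hr₀ : 0 ≤ r₀)
    (hsmall : L * ‖y‖ ≤ m / 2) {v : E} {w : F} (h0 : fderiv ℝ N (x, y) (v, w) = 0) :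
    m / 2 * ‖w‖ ≤ (L * ‖y‖ + ε₁) * ‖v‖ := by
  have hsplit : fderiv ℝ N (x, y) (v, w) = fderiv ℝ N (x, y) (v, 0) + fderiv ℝ N (x, y) (0, w) := by
    rw [← map_add]; congr 1; ext <;> simp
  have h1 : ‖fderiv ℝ N (x, y) (0, w)‖ = ‖fderiv ℝ N (x, y) (v, 0)‖ := by
    rw [hsplit] at h0
    rw [← norm_neg, (neg_eq_of_add_eq_zero_left h0)]
  have h2 := norm_fderiv_inl_sub_le hL0 hL hx hy hr₀ v
  have h3 := fibre_derivative_lower_bound hL0 hL hm hx hy hr₀ hsmall w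
  have h4 : ‖fderiv ℝ N (x, y) (v, 0)‖ ≤ L * ‖y‖ * ‖v‖ + ε₁ * ‖v‖ := by
    calc ‖fderiv ℝ N (x, y) (v, 0)‖
        ≤ ‖fderiv ℝ N (x, y) (v, 0) - fderiv ℝ N (x, 0) (v, 0)‖ + ‖fderiv ℝ N (x, 0) (v, 0)‖ :=
          norm_le_norm_sub_add _ _
      _ ≤ L * ‖y‖ * ‖v‖ + ε₁ * ‖v‖ := add_le_add h2 (hNx x hx v)
  calc m / 2 * ‖w‖ ≤ ‖fderiv ℝ N (x, y) (0, w)‖ := h3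
    _ = ‖fderiv ℝ N (x, y) (v, 0)‖ := h1
    _ ≤ L * ‖y‖ * ‖v‖ + ε₁ * ‖v‖ := h4
    _ = (L * ‖y‖ + ε₁) * ‖v‖ := by ring

/-- **Tangential displacement with offset**: `‖T (x, y) − x‖ ≤ M₁ ‖y‖ + ‖T (x, 0) − x‖`. [folklore] -/
theorem norm_tangential_sub_le_offset (hT : ContDiff ℝ ∞ T) {M₁ : ℝ}
    (hM : ∀ x ∈ K, ∀ y ∈ closedBall (0 : F) r₀, ‖fderiv ℝ T (x, y)‖ ≤ M₁) {x : E} (hx : x ∈ K)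
    {y : F} (hy : y ∈ closedBall (0 : F) r₀) (hr₀ : 0 ≤ r₀) :
    ‖T (x, y) - x‖ ≤ M₁ * ‖y‖ + ‖T (x, 0) - x‖ := by
  have h := norm_sub_apply_zero_le hT hM hx hy hr₀
  calc ‖T (x, y) - x‖ = ‖(T (x, y) - T (x, 0)) + (T (x, 0) - x)‖ := by rw [sub_add_sub_cancel]
    _ ≤ ‖T (x, y) - T (x, 0)‖ + ‖T (x, 0) - x‖ := norm_add_le _ _
    _ ≤ M₁ * ‖y‖ + ‖T (x, 0) - x‖ := add_le_add h le_rfl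

/-- **Tangential derivative with offset**: `‖D T(x, y)(v, 0) − v‖ ≤ (L‖y‖ + ε₁)‖v‖` where `ε₁` bounds
`‖D T(x, 0)(v, 0) − v‖ ≤ ε₁‖v‖` on the zero section. [folklore] -/
theorem norm_fderiv_tangential_inl_sub_le_offset {L ε₁ : ℝ} (hL0 : 0 ≤ L)
    (hL : ∀ x ∈ K, ∀ y ∈ closedBall (0 : F) r₀, ∀ y' ∈ closedBall (0 : F) r₀,
      ‖fderiv ℝ T (x, y) - fderiv ℝ T (x, y')‖ ≤ L * ‖y - y'‖)
    (hTx : ∀ x ∈ K, ∀ v : E, ‖fderiv ℝ T (x, 0) (v, 0) - v‖ ≤ ε₁ * ‖v‖)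
    {x : E} (hx : x ∈ K) {y : F} (hy : y ∈ closedBall (0 : F) r₀) (hr₀ : 0 ≤ r₀) (v : E) :
    ‖fderiv ℝ T (x, y) (v, 0) - v‖ ≤ (L * ‖y‖ + ε₁) * ‖v‖ := by
  have h := norm_fderiv_inl_sub_le hL0 hL hx hy hr₀ v
  calc ‖fderiv ℝ T (x, y) (v, 0) - v‖
      = ‖(fderiv ℝ T (x, y) (v, 0) - fderiv ℝ T (x, 0) (v, 0)) + (fderiv ℝ T (x, 0) (v, 0) - v)‖ := by
        rw [sub_add_sub_cancel]
    _ ≤ ‖fderiv ℝ T (x, y) (v, 0) - fderiv ℝ T (x, 0) (v, 0)‖ + ‖fderiv ℝ T (x, 0) (v, 0) - v‖ := norm_add_le _ _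
    _ ≤ L * ‖y‖ * ‖v‖ + ε₁ * ‖v‖ := add_le_add h (hTx x hx v)
    _ = (L * ‖y‖ + ε₁) * ‖v‖ := by ring

/-- **Upper bound for the normal part with offset**: `‖N (x, y)‖ ≤ M₁ ‖y‖ + ‖N (x, 0)‖`. [folklore] -/
theorem norm_normal_le_offset (hN : ContDiff ℝ ∞ N) {M₁ : ℝ}
    (hM : ∀ x ∈ K, ∀ y ∈ closedBall (0 : F) r₀, ‖fderiv ℝ N (x, y)‖ ≤ M₁) {x : E} (hx : x ∈ K)
    {y : F} (hy : y ∈ closedBall (0 : F) r₀) (hr₀ : 0 ≤ r₀) :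
    ‖N (x, y)‖ ≤ M₁ * ‖y‖ + ‖N (x, 0)‖ := by
  have h := norm_sub_apply_zero_le hN hM hx hy hr₀
  calc ‖N (x, y)‖ = ‖(N (x, y) - N (x, 0)) + N (x, 0)‖ := by rw [sub_add_cancel]
    _ ≤ ‖N (x, y) - N (x, 0)‖ + ‖N (x, 0)‖ := norm_add_le _ _
    _ ≤ M₁ * ‖y‖ + ‖N (x, 0)‖ := add_le_add h le_rfl

end Literature.Topology.FourManifolds
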